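import Literature.Geometry.DiscreteGeometry.SphericalCodeHullEulerFormula
import Summits.AtomisticToContinuum.Crystallization.Theses.TwoCentreKissingKernel
import HarnessLib

/-!
# `RobustTangencyBound` — soft contacts are hull edges; the defect budget (helper file)

Helper lemmas for item `stmt-AtomisticToContinuum-12082` (`RobustTangencyBound`, route
`TwoCentreKissingKernel`, sub-problem Crystallization), step (II) of the effective
Flatley–Tarasov–Taylor–Theil programme recorded in the item's notes: the face structure.

* `pair_mem_hullEdges_of_soft_contact` — the interval version of
  `Literature…pair_mem_hullEdges_of_contact`: in a finite set `X` of unit vectors of `ℝ³` whose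
  distinct pairs have inner product `≤ κ₂`, every pair with inner product `≥ κ₁` spans an
  exposed edge of `conv X` as soon as `2κ₂ < 1 + κ₁` (`κ₁ > −1`); the exposing functional is
  `⟪u + v, ·⟫`, equal to `1 + ⟪u, v⟫ ≥ 1 + κ₁` at `u, v` and `≤ 2κ₂` elsewhere.  (Route numbers:
  `κ₁ = 1/2 − 3η`, `κ₂ = 1/2 + 2η`: `1 + 4η < 3/2 − 3η`, any `η < 1/14`.)
* the **defect budget** `sum_card_tightSet_add_card_hullEdges`: `Σ_f m_f + E + 6 = 3F + 3N`
  for the facets `f` (with `m_f` vertices), hull edges `E`, facets `F` and points `N` of a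
  spherical code with `0` in the interior of its hull (Legendre's identity plus Euler's formula,
  both PROVED in the tree), whence `Σ_f (m_f − 3) + #(non-soft hull edges) = 3N − 6 − #S` for
  any `S ⊆ hullEdges`: for twelve points with `≥ 24` soft pairs the polygonal facets and the
  long edges share a budget of `6` (`defect_budget_le`, `defect_budget_le_six`).
-/

noncomputable section

namespace Summit.AtomisticToContinuum.Crystallization.Theorems

open Real RealInnerProductSpace Literature.Geometry.DiscreteGeometry Finset

variable {X : Finset (EuclideanSpace ℝ (Fin 3))}

/-- **Soft contact pairs span exposed edges of the hull.** Let `X` be a finite set of unit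
vectors of `ℝ³` whose distinct pairs have inner product `≤ κ₂`, and let `u ≠ v` in `X` have
`⟪u, v⟫ ≥ κ₁`, where `−1 < κ₁` and `2κ₂ < 1 + κ₁`. Then `{u, v}` is a hull edge of `X`: the
functional `c₀ = (u + v)/(1 + ⟪u, v⟫)` is `1` at `u` and `v` and `< 1` on every other point. -/
theorem pair_mem_hullEdges_of_soft_contact (hX1 : ∀ y ∈ X, ‖y‖ = 1) {κ₁ κ₂ : ℝ}
    (hκ₁ : -1 < κ₁) (hκ : 2 * κ₂ < 1 + κ₁)
    (hXκ : ∀ u ∈ X, ∀ v ∈ X, u ≠ v → ⟪u, v⟫ ≤ κ₂) {u v : EuclideanSpace ℝ (Fin 3)}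
    (hu : u ∈ X) (hv : v ∈ X) (hne : u ≠ v) (huv : κ₁ ≤ ⟪u, v⟫) :
    ({u, v} : Finset (EuclideanSpace ℝ (Fin 3))) ∈ hullEdges X := by
  classical
  set κ := ⟪u, v⟫ with hκdef
  have h1κ : 0 < 1 + κ := by linarith
  have huu : ⟪u, u⟫ = 1 := by rw [real_inner_self_eq_norm_sq, hX1 u hu]; norm_num
  have hvv : ⟪v, v⟫ = 1 := by rw [real_inner_self_eq_norm_sq, hX1 v hv]; norm_num
  have hvu : ⟪v, u⟫ = κ := by rw [hκdef, real_inner_comm]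
  set c₀ : EuclideanSpace ℝ (Fin 3) := (1 + κ)⁻¹ • (u + v) with hc₀
  have hc₀y : ∀ y, ⟪c₀, y⟫ = (1 + κ)⁻¹ * (⟪u, y⟫ + ⟪v, y⟫) := fun y => by
    rw [hc₀, real_inner_smul_left, inner_add_left]
  have hc₀u : ⟪c₀, u⟫ = 1 := by
    rw [hc₀y, huu, hvu, inv_mul_cancel₀ h1κ.ne']
  have hc₀v : ⟪c₀, v⟫ = 1 := by
    rw [hc₀y, ← hκdef, hvv, add_comm κ 1, inv_mul_cancel₀ h1κ.ne']
  have hlt : ∀ y ∈ X, y ≠ u → y ≠ v → ⟪c₀, y⟫ < 1 := by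
    intro y hy hyu hyv
    rw [hc₀y, inv_mul_lt_iff₀ h1κ, mul_one]
    have h1 := hXκ u hu y hy (Ne.symm hyu)
    have h2 := hXκ v hv y hy (Ne.symm hyv)
    linarith
  have hle : ∀ y ∈ X, ⟪c₀, y⟫ ≤ 1 := by
    intro y hy
    by_cases hyu : y = u
    · rw [hyu, hc₀u]
    by_cases hyv : y = v
    · rw [hyv, hc₀v]
    exact (hlt y hy hyu hyv).le
  have htight : tightSet X c₀ = {u, v} := by
    ext y
    rw [mem_tightSet, Finset.mem_insert, Finset.mem_singleton]
    constructor
    · rintro ⟨hy, hy1⟩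
      by_contra h
      push Not at h
      exact (hlt y hy h.1 h.2).ne hy1
    · rintro (rfl | rfl)
      · exact ⟨hu, hc₀u⟩
      · exact ⟨hv, hc₀v⟩
  refine mem_hullEdges.2 ⟨c₀, ⟨hle, ?_⟩, htight⟩
  rw [htight, Finset.card_pair hne]

/-- **Legendre plus Euler, as one subtraction-free identity.** For a finite set `X` of unit
vectors of `ℝ³` with `0` in the interior of its hull, with facets `f` having `m_f` vertices,
`E` hull edges and `F` facets: `Σ_f m_f + E + 6 = 3F + 3|X|`
(from `Σ_f m_f = 2|X| + 2F − 4` and `E + 2 = |X| + F`, both PROVED in the tree). -/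
theorem sum_card_tightSet_add_card_hullEdges (hX1 : ∀ y ∈ X, ‖y‖ = 1)
    (h0 : (0 : EuclideanSpace ℝ (Fin 3)) ∈
      interior (convexHull ℝ (X : Set (EuclideanSpace ℝ (Fin 3))))) :
    ∑ c ∈ facetNormals X, (tightSet X c).card + (hullEdges X).card + 6 =
      3 * (facetNormals X).card + 3 * X.card := by
  have h1 := sum_card_tightSet_eq hX1 h0
  have h2 := euler_formula hX1 h0
  have h1' : ((∑ c ∈ facetNormals X, (tightSet X c).card : ℕ) : ℝ) =
      2 * X.card + 2 * (facetNormals X).card - 4 := by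
    push_cast; exact h1
  have : ((∑ c ∈ facetNormals X, (tightSet X c).card + (hullEdges X).card + 6 : ℕ) : ℝ) =
      ((3 * (facetNormals X).card + 3 * X.card : ℕ) : ℝ) := by
    have h2' : ((hullEdges X).card : ℝ) + 2 = X.card + (facetNormals X).card := by
      exact_mod_cast h2
    push_cast
    linarith
  exact_mod_cast this

/-- Every facet has at least three vertices, so `3F ≤ Σ_f m_f`. -/
theorem three_mul_card_facetNormals_le (X : Finset (EuclideanSpace ℝ (Fin 3))) :
    3 * (facetNormals X).card ≤ ∑ c ∈ facetNormals X, (tightSet X c).card := by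
  rw [mul_comm, Finset.card_eq_sum_ones, Finset.sum_mul]
  exact Finset.sum_le_sum fun c hc => by simpa using three_le_card_tightSet hc

/-- **The defect budget of a soft kissing shell.** In the situation of
`sum_card_tightSet_add_card_hullEdges`, if `S ⊆ hullEdges X` (the soft contact pairs, say) then
`(Σ_f m_f − 3F) + (E − |S|) + |S| + 6 = 3|X|`, i.e. the polygonal excess `Σ_f (m_f − 3)` of the
facets and the number `E − |S|` of non-soft hull edges satisfy
`Σ_f (m_f − 3) + (E − |S|) = 3|X| − 6 − |S|` — for `|X| = 12` and `|S| ≥ 24` a total budget of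
at most `6` (stated subtraction-free). -/
theorem defect_budget_le (hX1 : ∀ y ∈ X, ‖y‖ = 1)
    (h0 : (0 : EuclideanSpace ℝ (Fin 3)) ∈
      interior (convexHull ℝ (X : Set (EuclideanSpace ℝ (Fin 3)))))
    {S : Finset (Finset (EuclideanSpace ℝ (Fin 3)))} (hS : S ⊆ hullEdges X) :
    (∑ c ∈ facetNormals X, (tightSet X c).card - 3 * (facetNormals X).card) +
        ((hullEdges X).card - S.card) + S.card + 6 = 3 * X.card := by
  have h := sum_card_tightSet_add_card_hullEdges hX1 h0
  have h3 := three_mul_card_facetNormals_le X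
  have hS' := Finset.card_le_card hS
  omega

/-- In particular, with twelve points and at least `24` soft pairs that are hull edges, the
facets' polygonal excess and the non-soft hull edges total at most `6`. -/
theorem defect_budget_le_six (hX1 : ∀ y ∈ X, ‖y‖ = 1)
    (h0 : (0 : EuclideanSpace ℝ (Fin 3)) ∈
      interior (convexHull ℝ (X : Set (EuclideanSpace ℝ (Fin 3)))))
    (hX : X.card = 12) {S : Finset (Finset (EuclideanSpace ℝ (Fin 3)))} (hS : S ⊆ hullEdges X)
    (hS24 : 24 ≤ S.card) :
    (∑ c ∈ facetNormals X, (tightSet X c).card - 3 * (facetNormals X).card) +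
        ((hullEdges X).card - S.card) ≤ 6 := by
  have h := defect_budget_le hX1 h0 hS
  omega

end Summit.AtomisticToContinuum.Crystallization.Theorems

end
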